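import Summits.BirchSwinnertonDyer.BirchSwinnertonDyer.Theorems.Rank2ObservatoryOrderCert2
import Summits.BirchSwinnertonDyer.BirchSwinnertonDyer.Theorems.Rank2ObservatoryLegendreCount
import HarnessLib

/-!
# BirchSwinnertonDyer — rank ≥ 2 observatory: the quadratic-twist complement (Hasse-free counts, v2)

HONEST FRAMING: per-curve certified theorems and census instruments; no claim on BSD in rank ≥ 2.

The ORDER CERTIFICATE of `Rank2ObservatoryOrderCert` certifies `#Ẽ(𝔽_q) = N` without point counting
and without Hasse, but only when `Ẽ(𝔽_q)` has a point of order `N > q + ½`, i.e. when the group is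
cyclic AND `a_q ≤ 0`. This module removes the sign condition by the QUADRATIC-TWIST COMPLEMENT:
for an odd prime `q` and a non-residue `u mod q`,
`#Ẽ(𝔽_q) + #Ẽ⁽ᵘ⁾(𝔽_q) = 2q + 2` (ELEMENTARY: per abscissa the two fibres have
`(1 + χ(D)) + (1 − χ(D))`
points), so an order certificate on the twist `Ẽ⁽ᵘ⁾` (which has `a_q⁽ᵘ⁾ = −a_q ≤ 0` exactly when
`a_q ≥ 0`) certifies `#Ẽ(𝔽_q)` exactly. Contents:

* `discYZ V q x = (a₁x + a₃)² + 4(x³ + a₂x² + a₄x + a₆)` and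
  **`zmodPointCount_eq_sum`**: `#Ẽ(𝔽_q) = q + 1 + ∑ₓ χ(discYZ V q x)` for `q ≠ 2`
  (fibrewise, from the landed `card_fibre_eq`);
* `twistModel V u = [0, u·b₂, 0, 8u²·b₄, 16u³·b₆]` (an integral model of the quadratic twist
  by `u`),
  `discYZ_twistModel : D⁽ᵘ⁾(4u·t) = (8u)²·u·D(t)`,
  `sum_quadraticChar_twistModel : ∑ χ(D⁽ᵘ⁾) = −∑ χ(D)`
  for `χ(u) = −1`, and **`zmodPointCount_add_twistModel : #Ẽ(𝔽_q) + #Ẽ⁽ᵘ⁾(𝔽_q) = 2q + 2`**;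
* `quadraticChar_eq_neg_one_of_eulerSqrtCount` (the kernel test `eulerSqrtCount q (u mod q) = 0`,
  Euler's criterion, landed), the Boolean **`twistCertB V (q, N, u, X, Y, [(r,e)…])`** = `q` a good
  odd prime, `u` a non-residue, `N ≤ 2q + 2`, and
  `orderCertB (twistModel V u) (q, 2q + 2 − N, X, Y, …)`,
  with **`killerB_of_twistCertB : twistCertB V c = true → killerB V (c.1, c.2.1) = true`** (drop-in
  like `killerB_of_orderCertB` / `killerB_of_killerLB`).

With `orderCertB` (for `a_q ≤ 0`) and `twistCertB` (for `a_q ≥ 0`) every good odd prime at which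
`Ẽ` resp. `Ẽ⁽ᵘ⁾` is cyclic gets an `O(log q)` kernel certificate of its point count; no count, no
Hasse bound anywhere. Sorry-free; no `decide` executed in this file.

References: J. H. Silverman, *The Arithmetic of Elliptic Curves* (2009) X.3 (twists), V.1;
J. E. Cremona, *Algorithms for Modular Elliptic Curves* (1997) §2.4; K. Ireland, M. Rosen,
*A Classical Introduction to Modern Number Theory* (1990) Prop. 5.1.2.
-/

-- single-conjunct summit: `Summit.BirchSwinnertonDyer.BirchSwinnertonDyer.…` repeats the name
set_option linter.dupNamespace false

namespace Summit.BirchSwinnertonDyer.BirchSwinnertonDyer.Rank2Observatory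

open WeierstrassCurve Finset

/-! ### The point count as a character sum -/

section Field

variable {q : ℕ} [Fact q.Prime]

/-- The discriminant in `y` of the Weierstrass equation at the abscissa `x`, over `ZMod q`:
`D(x) = (a₁x + a₃)² + 4(x³ + a₂x² + a₄x + a₆)`. [cite: CremonaAlgorithms1997, §2.4] -/
def discYZ (V : WeierstrassCurve ℤ) (q : ℕ) (x : ZMod q) : ZMod q :=
  ((V.a₁ : ZMod q) * x + (V.a₃ : ZMod q)) ^ 2 +
    4 * (x ^ 3 + (V.a₂ : ZMod q) * x ^ 2 + (V.a₄ : ZMod q) * x + (V.a₆ : ZMod q))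

/-- **`#Ẽ(𝔽_q) = q + 1 + ∑ₓ χ(D(x))`** for a prime `q ≠ 2` (fibrewise count and completing the
square, via the landed `card_fibre_eq`). [cite: CremonaAlgorithms1997, §2.4] -/
theorem zmodPointCount_eq_sum (V : WeierstrassCurve ℤ) (hq2 : q ≠ 2) :
    (zmodPointCount V q : ℤ) = q + 1 + ∑ x : ZMod q, quadraticChar (ZMod q) (discYZ V q x) := by
  classical
  have hpairs : #(univ.filter fun xy : ZMod q × ZMod q =>
      xy.2 ^ 2 + (V.a₁ : ZMod q) * xy.1 * xy.2 + (V.a₃ : ZMod q) * xy.2 =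
        xy.1 ^ 3 + (V.a₂ : ZMod q) * xy.1 ^ 2 + (V.a₄ : ZMod q) * xy.1 + (V.a₆ : ZMod q)) =
      ∑ x : ZMod q, #(univ.filter fun y : ZMod q =>
        y ^ 2 + (V.a₁ : ZMod q) * x * y + (V.a₃ : ZMod q) * y =
          x ^ 3 + (V.a₂ : ZMod q) * x ^ 2 + (V.a₄ : ZMod q) * x + (V.a₆ : ZMod q)) := by
    rw [card_filter, Fintype.sum_prod_type]
    refine sum_congr rfl fun x _ => ?_
    rw [card_filter]
  rw [zmodPointCount, hpairs]
  push_cast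
  rw [Finset.sum_congr rfl fun x _ => card_fibre_eq hq2 (V.a₁ : ZMod q) (V.a₂ : ZMod q)
    (V.a₃ : ZMod q) (V.a₄ : ZMod q) (V.a₆ : ZMod q) x, Finset.sum_add_distrib, Finset.sum_const,
    Finset.card_univ, ZMod.card q]
  simp only [discYZ]
  ring

/-! ### The quadratic twist and the complement identity -/

/-- An integral model of the quadratic twist by `u`: `[0, u·b₂, 0, 8u²·b₄, 16u³·b₆]`
(`y² = x³ + u b₂ x² + 8u² b₄ x + 16u³ b₆`, i.e. the twist of `y² = x³ + (b₂/4)x² + (b₄/2)x + b₆/4`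
rescaled by `x ↦ 4u·x`). [cite: SilvermanAEC2009, X.3] -/
def twistModel (V : WeierstrassCurve ℤ) (u : ℤ) : WeierstrassCurve ℤ :=
  ⟨0, u * V.b₂, 0, 8 * u ^ 2 * V.b₄, 16 * u ^ 3 * V.b₆⟩

/-- `D⁽ᵘ⁾(4u·t) = (8u)²·(u·D(t))`. [cite: SilvermanAEC2009, X.3] -/
theorem discYZ_twistModel (V : WeierstrassCurve ℤ) (u : ℤ) (t : ZMod q) :
    discYZ (twistModel V u) q (4 * (u : ZMod q) * t) =
      (8 * (u : ZMod q)) ^ 2 * ((u : ZMod q) * discYZ V q t) := by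
  simp only [discYZ, twistModel, WeierstrassCurve.b₂, WeierstrassCurve.b₄, WeierstrassCurve.b₆]
  push_cast
  ring

/-- For a non-residue `u`: `∑ₓ χ(D⁽ᵘ⁾(x)) = −∑ₜ χ(D(t))` (reindex `x = 4u·t`, multiplicativity of
`χ`, `χ((8u)²) = 1`, `χ(u) = −1`). [cite: IrelandRosen1990, Prop. 5.1.2] -/
theorem sum_quadraticChar_twistModel (V : WeierstrassCurve ℤ) (hq2 : q ≠ 2) {u : ℤ}
    (hχ : quadraticChar (ZMod q) (u : ZMod q) = -1) :
    ∑ x : ZMod q, quadraticChar (ZMod q) (discYZ (twistModel V u) q x) =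
      -∑ t : ZMod q, quadraticChar (ZMod q) (discYZ V q t) := by
  have hF : ringChar (ZMod q) ≠ 2 := by rwa [ZMod.ringChar_zmod_n]
  have h2 : (2 : ZMod q) ≠ 0 := Ring.two_ne_zero hF
  have hu : (u : ZMod q) ≠ 0 := by
    intro h
    rw [h, MulChar.map_zero] at hχ
    exact absurd hχ (by norm_num)
  have h4u : 4 * (u : ZMod q) ≠ 0 := by
    have h4 : (4 : ZMod q) ≠ 0 := by
      rw [show (4 : ZMod q) = 2 * 2 by norm_num]; exact mul_ne_zero h2 h2
    exact mul_ne_zero h4 hu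
  have h8u : 8 * (u : ZMod q) ≠ 0 := by
    have h8 : (8 : ZMod q) ≠ 0 := by
      rw [show (8 : ZMod q) = 2 * 2 * 2 by norm_num]; exact mul_ne_zero (mul_ne_zero h2 h2) h2
    exact mul_ne_zero h8 hu
  rw [← Fintype.sum_bijective (fun t : ZMod q => 4 * (u : ZMod q) * t)
    (mulLeft_bijective₀ (4 * (u : ZMod q)) h4u)
    (fun t => quadraticChar (ZMod q) (discYZ (twistModel V u) q (4 * (u : ZMod q) * t)))
    (fun x => quadraticChar (ZMod q) (discYZ (twistModel V u) q x)) (fun _ => rfl)]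
  rw [← Finset.sum_neg_distrib]
  refine Finset.sum_congr rfl fun t _ => ?_
  rw [discYZ_twistModel, map_mul, map_mul, quadraticChar_sq_one' h8u, hχ]
  ring

/-- **THE TWIST COMPLEMENT** `#Ẽ(𝔽_q) + #Ẽ⁽ᵘ⁾(𝔽_q) = 2q + 2` for an odd prime `q` and a
non-residue `u`. [cite: SilvermanAEC2009, X.3] -/
theorem zmodPointCount_add_twistModel (V : WeierstrassCurve ℤ) (hq2 : q ≠ 2) {u : ℤ}
    (hχ : quadraticChar (ZMod q) (u : ZMod q) = -1) :
    zmodPointCount V q + zmodPointCount (twistModel V u) q = 2 * q + 2 := by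
  have h1 := zmodPointCount_eq_sum V hq2
  have h2 := zmodPointCount_eq_sum (twistModel V u) hq2
  rw [sum_quadraticChar_twistModel V hq2 hχ] at h2
  have h : ((zmodPointCount V q + zmodPointCount (twistModel V u) q : ℕ) : ℤ) = 2 * q + 2 := by
    push_cast; linarith
  exact_mod_cast h

/-- The kernel test for "`u` is a non-residue mod `q`": `eulerSqrtCount q (u mod q) = 0`
(Euler's criterion, landed as `eulerSqrtCount_eq_quadraticChar`).
[cite: IrelandRosen1990, Prop. 5.1.2] -/
theorem quadraticChar_eq_neg_one_of_eulerSqrtCount (hq2 : q ≠ 2) {u : ℤ}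
    (h : eulerSqrtCount q (redMod q u) = 0) : quadraticChar (ZMod q) (u : ZMod q) = -1 := by
  have e := eulerSqrtCount_eq_quadraticChar hq2 (redMod q u)
  rw [h, natCast_redMod] at e
  push_cast at e
  linarith

end Field

/-! ### The drop-in killer Boolean -/

/-- One TWIST CERTIFICATE `(q, N, u, X, Y, [(r,e)…])` (Boolean): `q` a good odd prime of `V`
(trial division), `u` a non-residue (Euler's criterion), `N ≤ 2q + 2`, and an ORDER CERTIFICATE
(`orderCertB`) for the twist: `(X, Y)` is a point of `Ẽ⁽ᵘ⁾(𝔽_q)` of exact order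
`2q + 2 − N > q + ½`.
Then `#Ẽ(𝔽_q) = N` — no point counting. [cite: SilvermanAEC2009, X.3] -/
def twistCertB (V : WeierstrassCurve ℤ) : ℕ × ℕ × ℤ × ℤ × ℤ × List (ℕ × ℕ) → Bool
  | (0, _) => false
  | (ℓ + 1, N, u, X, Y, fs) =>
    goodPrimeTB V (ℓ + 1) && decide ((ℓ + 1) % 2 = 1) &&
    (eulerSqrtCount (ℓ + 1) (redMod (ℓ + 1) u) == 0) && decide (N ≤ 2 * (ℓ + 1) + 2) &&
    orderCertB (twistModel V u) (ℓ + 1, 2 * (ℓ + 1) + 2 - N, X, Y, fs)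

/-- **`twistCertB ⇒ killerB`**: a checked twist certificate gives the landed killer Boolean (same
prime, same count), so every soundness theorem stated over `killerB` applies verbatim.
[cite: SilvermanAEC2009, X.3] -/
theorem killerB_of_twistCertB (V : WeierstrassCurve ℤ) {c : ℕ × ℕ × ℤ × ℤ × ℤ × List (ℕ × ℕ)}
    (h : twistCertB V c = true) : killerB V (c.1, c.2.1) = true := by
  obtain ⟨ℓ, N, u, X, Y, fs⟩ := c
  cases ℓ with
  | zero => simp [twistCertB] at h
  | succ ℓ =>
    simp only [twistCertB, Bool.and_eq_true, decide_eq_true_eq, beq_iff_eq] at h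
    obtain ⟨⟨⟨⟨hgood, hodd⟩, heu⟩, hN⟩, hoc⟩ := h
    have hgood' := goodPrimeB_of_goodPrimeTB V hgood
    have hg2 := hgood'
    rw [goodPrimeB, Bool.and_eq_true, decide_eq_true_eq, decide_eq_true_eq] at hg2
    obtain ⟨hprime, hΔ⟩ := hg2
    haveI : Fact (ℓ + 1).Prime := ⟨hprime⟩
    have hq2 : ℓ + 1 ≠ 2 := by omega
    have hχ := quadraticChar_eq_neg_one_of_eulerSqrtCount hq2 heu
    -- the order certificate on the twist gives its count
    have hk := killerB_of_orderCertB (twistModel V u) hoc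
    simp only [killerB, Bool.and_eq_true, beq_iff_eq] at hk
    obtain ⟨_, htw⟩ := hk
    have hsum := zmodPointCount_add_twistModel V hq2 hχ
    rw [killerB, Bool.and_eq_true]
    refine ⟨hgood', ?_⟩
    rw [beq_iff_eq]
    show zmodPointCount V (ℓ + 1) = N
    omega

/-- List form: `S.all (twistCertB V) ⇒ (S.map ⋯).all (killerB V)`. [folklore] -/
theorem all_killerB_of_all_twistCertB (V : WeierstrassCurve ℤ)
    {S : List (ℕ × ℕ × ℤ × ℤ × ℤ × List (ℕ × ℕ))} (h : S.all (twistCertB V) = true) :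
    (S.map fun c => (c.1, c.2.1)).all (killerB V) = true := by
  rw [List.all_eq_true] at h ⊢
  intro x hx
  obtain ⟨c, hc, rfl⟩ := List.mem_map.mp hx
  exact killerB_of_twistCertB V (h c hc)

/-- TWIST TWO-POINT CERTIFICATE `(ℓ, N, u, X, Y, fs, r, X₂, Y₂)`: as `twistCertB`, but the count of
the twist `2ℓ + 2 − N` is certified by the two-point certificate `orderCert2B` (twist group
`ℤ/m × ℤ/r`, `r ∈ {2, 3}`). [cite: SilvermanAEC2009, X.3] -/
def twistCert2B (V : WeierstrassCurve ℤ) :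
    ℕ × ℕ × ℤ × ℤ × ℤ × List (ℕ × ℕ) × ℕ × ℤ × ℤ → Bool
  | (0, _) => false
  | (ℓ + 1, N, u, X, Y, fs, r, X₂, Y₂) =>
    goodPrimeTB V (ℓ + 1) && decide ((ℓ + 1) % 2 = 1) &&
    (eulerSqrtCount (ℓ + 1) (redMod (ℓ + 1) u) == 0) && decide (N ≤ 2 * (ℓ + 1) + 2) &&
    orderCert2B (twistModel V u) (ℓ + 1, 2 * (ℓ + 1) + 2 - N, X, Y, fs, r, X₂, Y₂)

/-- **`twistCert2B ⇒ killerB`**. [cite: SilvermanAEC2009, X.3] -/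
theorem killerB_of_twistCert2B (V : WeierstrassCurve ℤ)
    {c : ℕ × ℕ × ℤ × ℤ × ℤ × List (ℕ × ℕ) × ℕ × ℤ × ℤ}
    (h : twistCert2B V c = true) : killerB V (c.1, c.2.1) = true := by
  obtain ⟨ℓ, N, u, X, Y, fs, r, X₂, Y₂⟩ := c
  cases ℓ with
  | zero => simp [twistCert2B] at h
  | succ ℓ =>
    simp only [twistCert2B, Bool.and_eq_true, decide_eq_true_eq, beq_iff_eq] at h
    obtain ⟨⟨⟨⟨hgood, hodd⟩, heu⟩, hN⟩, hoc⟩ := h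
    have hgood' := goodPrimeB_of_goodPrimeTB V hgood
    have hg2 := hgood'
    rw [goodPrimeB, Bool.and_eq_true, decide_eq_true_eq, decide_eq_true_eq] at hg2
    obtain ⟨hprime, hΔ⟩ := hg2
    haveI : Fact (ℓ + 1).Prime := ⟨hprime⟩
    have hq2 : ℓ + 1 ≠ 2 := by omega
    have hχ := quadraticChar_eq_neg_one_of_eulerSqrtCount hq2 heu
    have hk := killerB_of_orderCert2B (twistModel V u) hoc
    simp only [killerB, Bool.and_eq_true, beq_iff_eq] at hk
    obtain ⟨_, htw⟩ := hk
    have hsum := zmodPointCount_add_twistModel V hq2 hχ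
    rw [killerB, Bool.and_eq_true]
    refine ⟨hgood', ?_⟩
    rw [beq_iff_eq]
    show zmodPointCount V (ℓ + 1) = N
    omega

/-- List form: `S.all (twistCert2B V) ⇒ (S.map ⋯).all (killerB V)`. [folklore] -/
theorem all_killerB_of_all_twistCert2B (V : WeierstrassCurve ℤ)
    {S : List (ℕ × ℕ × ℤ × ℤ × ℤ × List (ℕ × ℕ) × ℕ × ℤ × ℤ)}
    (h : S.all (twistCert2B V) = true) :
    (S.map fun c => (c.1, c.2.1)).all (killerB V) = true := by
  rw [List.all_eq_true] at h ⊢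
  intro x hx
  obtain ⟨c, hc, rfl⟩ := List.mem_map.mp hx
  exact killerB_of_twistCert2B V (h c hc)

end Summit.BirchSwinnertonDyer.BirchSwinnertonDyer.Rank2Observatory
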